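import Literature.MathematicalPhysics.QuantumManyBody.PeriodicBoseGasImpurityTranslation
import Literature.MathematicalPhysics.QuantumManyBody.OneParticleMarginals
import Mathlib.GroupTheory.Perm.Fin
import HarnessLib

/-!
# The periodic Bose gas with a tagged particle of tunable mass (two-species torus gas)

Topic `Literature/MathematicalPhysics/QuantumManyBody` (definition item `defn-taggedPeriodicEnergy`,
wanted by route `BECProbeMassFlow` of `AtomisticToContinuum/BoseEinsteinCondensation` — the foreseen
split `TaggedEndpointIdentity → MassFlowComparison` of its crux `RecoilTransfer` — and by the
impurity/polaron idea cards one-particle-at-a-time, kv-insertion-corrector,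
frozen-bath-anderson-endpoint). Companion of `PeriodicBoseGas.lean` and `PeriodicBoseGasImpurity.lean`
(namespace `Literature.MathematicalPhysics.QuantumManyBody.BoseGas`), whose carriers it reuses
verbatim: the torus cells `cell L = [0,L)³`, `cellN N L = [0,L)^{3N}`, the periodised pair potential
`periodizedPotential v L = v^per` [Fournais2020, (1.1)], periodic trial states `PeriodicTrialState`,
`periodicEnergy`, `periodicInteraction`, `condensateOccupation`, and the pinned-scatterer objects
`impurityInteraction v L x Y = ∑ⱼ v^per(yⱼ - x)`, `impurityPeriodicEnergy v x Φ`.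

## Content

Write `X = (x₀, Y) ∈ (ℝ³)^{N+1}`, `Y = (x₁, …, x_N)`; particle `0` (the head of `Matrix.vecCons`,
as in `occupation`) is the **tagged** particle, particles `1, …, N` are the **bath**.

* `TaggedPeriodicTrialState N L` — wave functions `Ψ : (ℝ³)^{N+1} → ℂ` of class `C¹`,
  `Lℤ³`-periodic in every particle coordinate (on the generators `L e_{i,k}`, as
  `PeriodicTrialState`), symmetric under the permutations of the labels that FIX the tag `0`
  (i.e. under permutations of the bath particles only: the tagged particle is distinguishable),
  and normalised on `cellN (N+1) L`. A two-species (1 + `N`) bosonic state on the torus `ℝ³/Lℤ³`.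
* `taggedKineticDensity κ Ψ X = κ |∇₀Ψ(X)|² + ∑_{j ≥ 1} |∇ⱼΨ(X)|²` — the kinetic density in which
  the tagged particle carries the weight `κ = m/M` (mass ratio bath/tagged; `κ : ℝ` enters through
  `ENNReal.ofReal`, so `κ ≤ 0` acts as `κ = 0`, the static limit `M = ∞`).
* `taggedInteraction v L X = ∑_{j ≥ 1} v^per(x_j - x₀) + ∑_{1 ≤ i < j} v^per(x_i - x_j)` — the tagged
  particle couples to the bath through the SAME pair potential `v` (it is a tagged boson), written
  as `impurityInteraction v L (X 0) (tail X) + periodicInteraction v L (tail X)`: the bath sees the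
  tagged particle as a scatterer sitting at `x₀`. By evenness of `v^per` this IS Fournais's full
  pair interaction of the `N + 1` particles (`taggedInteraction_eq_periodicInteraction`).
* `taggedPeriodicEnergy v κ Ψ = ∫_{[0,L)^{3(N+1)}} (κ|∇₀Ψ|² + ∑_{j≥1}|∇ⱼΨ|² + (∑_{j≥1} v^per(xⱼ-x₀)
  + ∑_{1≤i<j} v^per(xᵢ-xⱼ)) |Ψ|²) dX` — the quadratic form of the mass-deformed torus Hamiltonian
  `H_κ = -κΔ₀ - ∑_{j≥1} Δⱼ + ∑_{j≥1} v^per(xⱼ - x₀) + ∑_{1≤i<j} v^per(xᵢ - xⱼ)` (units `ħ = 2m = 1`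
  for the bath mass `m`): the Bose-polaron / mobile-impurity Hamiltonian of
  [GuentherEtAl2021, eq. (4)] at finite impurity mass `m_I = m/κ` with impurity–boson coupling
  `U = v`, in first quantisation and in the periodic setting of [Fournais2020, (1.1)]; `ℝ≥0∞`-valued
  like `periodicEnergy`.
* `taggedPeriodicGroundStateEnergy v κ N L = inf_Ψ taggedPeriodicEnergy v κ Ψ`.
* `taggedZeroModeOccupation N L Ψ = L⁻³ ∫_{[0,L)^{3N}} |∫_{[0,L)³} Ψ(x₀, Y) dx₀|² dY =
  ∫ |∫ L^{-3/2} Ψ(x₀, Y) dx₀|² dY ∈ [0, 1]` — the occupation `⟨Ψ, P_{Ω,0} Ψ⟩` of the constant mode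
  by the tagged particle [Fournais2020, (1.3)–(1.4) for `j = 0`]; `(N+1)` times it is
  `condensateOccupation (N+1) L Ψ` [LSSY2005, §1.2 (1.17)].

## API (all proved)

* unfolding: `taggedKineticDensity_def`, `taggedInteraction_def`, `taggedPeriodicEnergy_def`,
  `taggedPeriodicGroundStateEnergy_def`, `taggedZeroModeOccupation_def` (`rfl` against the inline
  expressions a planner would write); variational principle `taggedPeriodicGroundStateEnergy_le`.
* `κ = 1` (equal masses): `taggedKineticDensity_one` (`= kineticDensity`),
  `periodizedPotential_neg` (`v^per` is even), `periodicInteraction_succ` (splitting the pair sum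
  at the tag), `taggedInteraction_eq_periodicInteraction`, `taggedPeriodicEnergy_one`; a fully
  symmetric `Φ : PeriodicTrialState (N+1) L` is a tagged state `Φ.toTagged` with
  `taggedPeriodicEnergy v 1 Φ.toTagged = periodicEnergy v Φ` (`taggedPeriodicEnergy_one_toTagged`),
  whence `taggedPeriodicGroundStateEnergy v 1 N L ≤ periodicGroundStateEnergy v (N+1) L`; and
  `(N+1) · taggedZeroModeOccupation N L Ψ = condensateOccupation (N+1) L Ψ`
  (`succ_mul_taggedZeroModeOccupation`, any `Ψ`), `taggedZeroModeOccupation_le_one`.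
* monotonicity in the mass ratio: `taggedKineticDensity_mono`, `taggedPeriodicEnergy_mono`,
  `taggedPeriodicGroundStateEnergy_mono` (`κ ≤ κ'` gives `≤`), `taggedPeriodicEnergy_of_nonpos`.
* bath symmetry in `vecCons` form (`TaggedPeriodicTrialState.symm_vecCons`) and the restriction of
  a tag-fixing permutation to the bath (`exists_perm_bath`).
* `κ = 0` (static limit) and product states: for a one-body periodic `C¹` function `f` normalised
  on the cell and `Φ : PeriodicTrialState N L`, `TaggedPeriodicTrialState.product f … Φ` is the
  state `f(x₀) Φ(Y)`, and for measurable `v`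
  `taggedPeriodicEnergy v κ (product f Φ) = κ ∫_cell |∇f|² + ∫_cell |f(x₀)|² E_imp[x₀; Φ] dx₀`
  with `E_imp[x₀; Φ] = impurityPeriodicEnergy v x₀ Φ` (`taggedPeriodicEnergy_product`); in
  particular at `κ = 0` the energy is the `|f|²`-average of the pinned-scatterer energy
  (`taggedPeriodicEnergy_zero_product`).
* translation covariance: `TaggedPeriodicTrialState.exists_translate` (moving all `N + 1`
  particles by `t ∈ ℝ³` gives a tagged state), `taggedPeriodicEnergy_translate` (same energy),
  lattice periodicity of the two densities (`taggedKineticDensity_add_single`,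
  `taggedInteraction_add_single`, `taggedInteraction_add_const`).
* non-vacuity: `TaggedPeriodicTrialState.const` (the constant state, `0 < L`),
  `TaggedPeriodicTrialState.side_pos` (a tagged state forces `0 < L`),
  `taggedPeriodicGroundStateEnergy_of_nonpos` (`= ⊤` for `L ≤ 0`).

## Design choices

* The tag is the label `0 : Fin (N+1)` (head of `Matrix.vecCons`, the convention of `occupation`,
  `OneParticleMarginals.lean`, `SwapPurity.lean`), so `condensateOccupation (N+1) L Ψ / (N+1)` is
  exactly the tagged zero-mode weight (`succ_mul_taggedZeroModeOccupation`).
* Bath symmetry is stated as invariance under `σ : Equiv.Perm (Fin (N+1))` with `σ 0 = 0`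
  (closest to `PeriodicTrialState.symm`); the `vecCons` form `Ψ(x, Y ∘ σ) = Ψ(x, Y)` is the
  theorem `symm_vecCons`.
* `κ : ℝ` through `ENNReal.ofReal κ` (the requester's `κ = m/M ∈ [0,1]`); `0 · ⊤ = 0` in `ℝ≥0∞`, so at
  `κ = 0` an infinite tagged kinetic integral is harmless, as it must be in the static limit.
* No notion is duplicated: per-particle gradients are the summands of `kineticDensity`
  (local notation `gradSqAt`, as in `PeriodicBoseGasThm31.lean`), the one-body gradient is
  `gradSqC` (`PeriodicBoseGasLocalization.lean`), the potential terms are `impurityInteraction` and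
  `periodicInteraction`. Mathlib has no many-body Schrödinger operators, impurities or polarons
  (searched `polaron`, `impurity`, `tagged`, `Bose`).

## References

* [GuentherEtAl2021] N.-E. Guenther, R. Schmidt, G. M. Bruun, V. Gurarie, P. Massignan, *Mobile
  impurity in a Bose–Einstein condensate and the orthogonality catastrophe*, Phys. Rev. A 103,
  013317 (2021), arXiv:2004.07166: eq. (4) (impurity of finite mass `m_I` coupled to the bosons by
  `U`; here `U = v` and `κ = m/m_I`).
* [Fournais2020] S. Fournais, *Length scales for BEC in the dilute Bose gas*, arXiv:2011.00309,
  EMS Ser. Congr. Rep. 18 (2021): (1.1) `H = ∑ⱼ -Δⱼ^per + ∑_{j<k} v^per(xⱼ - x_k)`, (1.2) `E(N,L)`,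
  (1.3)–(1.4) `P_{Ω,j}`, `n₀ = ∑ⱼ P_{Ω,j}`.
* [LSSY2005] E. H. Lieb, R. Seiringer, J. P. Solovej, J. Yngvason, *The Mathematics of the Bose Gas
  and its Condensation*, Birkhäuser 2005: §1.2 (1.16)–(1.18) (quadratic form, one-particle density
  matrix, occupation).
-/

noncomputable section

open MeasureTheory
open scoped ENNReal NNReal ComplexConjugate

namespace Literature.MathematicalPhysics.QuantumManyBody.BoseGas

/-- The partial gradient in particle `i`: `|∇ᵢΨ(X)|² = ∑ₖ |∂Ψ/∂x_{i,k}(X)|²` (local notation for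
the `i`-th summand of `kineticDensity`, as in `PeriodicBoseGasThm31.lean`). -/
local notation "gradSqAt[" i ", " Ψ ", " X "]" =>
  ∑ k : Fin 3, (‖fderiv ℝ Ψ X (Pi.single i (EuclideanSpace.single k (1 : ℝ)))‖₊ : ℝ≥0∞) ^ 2

variable {N : ℕ} {L : ℝ}

/-! ### Trial states with a tagged particle -/

/-- Admissible trial wave functions for ONE tagged particle (label `0`) and `N` bath bosons on the
torus `ℝ³/Lℤ³`: `Ψ : (ℝ³)^{N+1} → ℂ` of class `C¹`, `Lℤ³`-periodic in every particle coordinate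
(on the generators `L e_{i,k}`), symmetric under the permutations of the bath particles `1, …, N`
(the permutations `σ` of the `N + 1` labels with `σ 0 = 0`; NO symmetry in the tagged particle,
which is distinguishable), and normalised on the fundamental cell `[0,L)^{3(N+1)}`. Empty for
`L ≤ 0`. [cite: GuentherEtAl2021, eq. (4) (one impurity + N bosons; periodic setting of Fournais2020 (1.1))] -/
structure TaggedPeriodicTrialState (N : ℕ) (L : ℝ) where
  /-- The wave function `Ψ(x₀, x₁, …, x_N)` on `(ℝ³)^{N+1}`; `x₀ = X 0` is the tagged particle. -/
  ψ : Config (N + 1) → ℂ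
  /-- `Ψ` is `C¹`. -/
  contDiff : ContDiff ℝ 1 ψ
  /-- Periodicity: `Ψ(…, xᵢ + L e_k, …) = Ψ(…, xᵢ, …)` for every particle `i` and axis `k`. -/
  periodic : ∀ (X : Config (N + 1)) (i : Fin (N + 1)) (k : Fin 3),
    ψ (X + Pi.single i (EuclideanSpace.single k L)) = ψ X
  /-- Bose symmetry of the bath: invariance under the permutations of the labels fixing the tag `0`. -/
  symm : ∀ σ : Equiv.Perm (Fin (N + 1)), σ 0 = 0 → ∀ X : Config (N + 1), ψ (X ∘ σ) = ψ X
  /-- Normalisation on the fundamental cell: `∫_{[0,L)^{3(N+1)}} |Ψ|² = 1`. -/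
  norm_eq : ∫⁻ X in cellN (N + 1) L, (‖ψ X‖₊ : ℝ≥0∞) ^ 2 = 1

/-! ### The mass-deformed energy -/

/-- The **mass-deformed kinetic density** `κ |∇₀Ψ(X)|² + ∑_{j ≥ 1} |∇ⱼΨ(X)|²`: the tagged particle
`0` carries the kinetic weight `κ = m/M` (through `ENNReal.ofReal`, so `κ ≤ 0` acts as the static
limit `κ = 0`), the bath particles the weight `1` (units `ħ = 2m = 1`).
[cite: GuentherEtAl2021, eq. (4) (kinetic terms, m_I = m/κ)] -/
def taggedKineticDensity (κ : ℝ) (ψ : Config (N + 1) → ℂ) (X : Config (N + 1)) : ℝ≥0∞ :=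
  ENNReal.ofReal κ * gradSqAt[(0 : Fin (N + 1)), ψ, X] + ∑ j : Fin N, gradSqAt[j.succ, ψ, X]

/-- The **potential energy of the tagged configuration** `X = (x₀, Y)`:
`∑_{j ≥ 1} v^per(xⱼ - x₀) + ∑_{1 ≤ i < j} v^per(xᵢ - xⱼ)` — the bath feels the tagged particle as a
scatterer at `x₀` coupled by the SAME periodised pair potential (`impurityInteraction`), plus its own
pair interaction (`periodicInteraction` of the tail). Equal to the full pair interaction of the
`N + 1` particles (`taggedInteraction_eq_periodicInteraction`).
[cite: GuentherEtAl2021, eq. (4) (U = v; periodised as in Fournais2020 (1.1))] -/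
def taggedInteraction (v : ℝ → ℝ≥0∞) (L : ℝ) (X : Config (N + 1)) : ℝ≥0∞ :=
  impurityInteraction v L (X 0) (Matrix.vecTail X) + periodicInteraction v L (Matrix.vecTail X)

/-- The **mass-deformed tagged energy** on the torus,
`⟨Ψ, H_κ Ψ⟩ = ∫_{[0,L)^{3(N+1)}} (κ|∇₀Ψ|² + ∑_{j≥1} |∇ⱼΨ|² + (∑_{j≥1} v^per(xⱼ - x₀) +
∑_{1≤i<j} v^per(xᵢ - xⱼ)) |Ψ|²) dX`, the quadratic form of
`H_κ = -κΔ₀ - ∑_{j≥1} Δⱼ + ∑_{j≥1} v^per(xⱼ - x₀) + ∑_{1≤i<j} v^per(xᵢ - xⱼ)` — one impurity of mass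
`M = m/κ` among `N` bosons of mass `m`, impurity–boson coupling equal to the boson–boson one, on
`ℝ³/Lℤ³` (`κ = 1`: Fournais's `H(N+1, L)` on tagged states; `κ = 0`: the pinned scatterer).
[cite: GuentherEtAl2021, eq. (4) (finite m_I; quadratic form, periodic setting of Fournais2020 (1.1))] -/
def taggedPeriodicEnergy (v : ℝ → ℝ≥0∞) (κ : ℝ) (Ψ : TaggedPeriodicTrialState N L) : ℝ≥0∞ :=
  ∫⁻ X in cellN (N + 1) L,
    taggedKineticDensity κ Ψ.ψ X + taggedInteraction v L X * (‖Ψ.ψ X‖₊ : ℝ≥0∞) ^ 2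

/-- The **mass-deformed ground-state energy** `E_κ(N, L) = inf_Ψ ⟨Ψ, H_κ Ψ⟩` over the tagged
trial states (`⊤` if `L ≤ 0`). [cite: GuentherEtAl2021, eq. (4) (with Fournais2020 (1.2))] -/
def taggedPeriodicGroundStateEnergy (v : ℝ → ℝ≥0∞) (κ : ℝ) (N : ℕ) (L : ℝ) : ℝ≥0∞ :=
  ⨅ Ψ : TaggedPeriodicTrialState N L, taggedPeriodicEnergy v κ Ψ

/-- The **zero-mode occupation of the tagged particle**
`⟨Ψ, P_{Ω,0} Ψ⟩ = L⁻³ ∫_{[0,L)^{3N}} |∫_{[0,L)³} Ψ(x₀, Y) dx₀|² dY = ∫ |∫ L^{-3/2} Ψ(x₀, Y) dx₀|² dY`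
(`P_Ω = L⁻³|1⟩⟨1|` acting on the tagged coordinate), a number in `[0, 1]` for a normalised state;
`(N+1)` times it is `condensateOccupation (N+1) L Ψ`.
[cite: Fournais2020, (1.3)–(1.4) (P_{Ω,j} for the tagged j = 0)] -/
def taggedZeroModeOccupation (N : ℕ) (L : ℝ) (Ψ : Config (N + 1) → ℂ) : ℝ≥0∞ :=
  (ENNReal.ofReal L ^ 3)⁻¹ *
    ∫⁻ Y in cellN N L, (‖∫ x in cell L, Ψ (Matrix.vecCons x Y)‖₊ : ℝ≥0∞) ^ 2

/-! ### Definitional unfolding -/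

/-- `taggedKineticDensity` unfolds to `κ ∑ₖ |∂_{0,k}Ψ|² + ∑_{j} ∑ₖ |∂_{j+1,k}Ψ|²`. [folklore] -/
theorem taggedKineticDensity_def (κ : ℝ) (ψ : Config (N + 1) → ℂ) (X : Config (N + 1)) :
    taggedKineticDensity κ ψ X =
      ENNReal.ofReal κ * ∑ k : Fin 3,
          (‖fderiv ℝ ψ X (Pi.single 0 (EuclideanSpace.single k (1 : ℝ)))‖₊ : ℝ≥0∞) ^ 2 +
        ∑ j : Fin N, ∑ k : Fin 3,
          (‖fderiv ℝ ψ X (Pi.single j.succ (EuclideanSpace.single k (1 : ℝ)))‖₊ : ℝ≥0∞) ^ 2 :=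
  rfl

/-- `taggedInteraction` unfolds to `∑ⱼ v^per(x_{j+1} - x₀) + ∑_{i<j} v^per(x_{i+1} - x_{j+1})`.
[folklore] -/
theorem taggedInteraction_def (v : ℝ → ℝ≥0∞) (L : ℝ) (X : Config (N + 1)) :
    taggedInteraction v L X =
      (∑ j : Fin N, periodizedPotential v L (X j.succ - X 0)) +
        ∑ i : Fin N, ∑ j : Fin N with i < j, periodizedPotential v L (X i.succ - X j.succ) :=
  rfl

/-- `taggedInteraction` in terms of the pinned-scatterer potential of `PeriodicBoseGasImpurity.lean`.
[folklore] -/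
theorem taggedInteraction_eq (v : ℝ → ℝ≥0∞) (L : ℝ) (X : Config (N + 1)) :
    taggedInteraction v L X =
      impurityInteraction v L (X 0) (Matrix.vecTail X) + periodicInteraction v L (Matrix.vecTail X) :=
  rfl

/-- `taggedPeriodicEnergy` unfolds to the integral of the two densities. [folklore] -/
theorem taggedPeriodicEnergy_def (v : ℝ → ℝ≥0∞) (κ : ℝ) (Ψ : TaggedPeriodicTrialState N L) :
    taggedPeriodicEnergy v κ Ψ = ∫⁻ X in cellN (N + 1) L,
      taggedKineticDensity κ Ψ.ψ X + taggedInteraction v L X * (‖Ψ.ψ X‖₊ : ℝ≥0∞) ^ 2 :=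
  rfl

/-- `taggedPeriodicGroundStateEnergy` unfolds to the infimum. [folklore] -/
theorem taggedPeriodicGroundStateEnergy_def (v : ℝ → ℝ≥0∞) (κ : ℝ) (N : ℕ) (L : ℝ) :
    taggedPeriodicGroundStateEnergy v κ N L =
      ⨅ Ψ : TaggedPeriodicTrialState N L, taggedPeriodicEnergy v κ Ψ :=
  rfl

/-- `taggedZeroModeOccupation` unfolds to `L⁻³ ∫ |∫ Ψ(x₀, Y) dx₀|² dY`. [folklore] -/
theorem taggedZeroModeOccupation_def (N : ℕ) (L : ℝ) (Ψ : Config (N + 1) → ℂ) :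
    taggedZeroModeOccupation N L Ψ = (ENNReal.ofReal L ^ 3)⁻¹ *
      ∫⁻ Y in cellN N L, (‖∫ x in cell L, Ψ (Matrix.vecCons x Y)‖₊ : ℝ≥0∞) ^ 2 :=
  rfl

/-- Variational principle for the mass-deformed problem. [folklore] -/
theorem taggedPeriodicGroundStateEnergy_le (v : ℝ → ℝ≥0∞) (κ : ℝ) (Ψ : TaggedPeriodicTrialState N L) :
    taggedPeriodicGroundStateEnergy v κ N L ≤ taggedPeriodicEnergy v κ Ψ :=
  iInf_le _ Ψ

/-! ### Monotonicity in the mass ratio `κ` -/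

/-- The kinetic density is monotone in the tagged weight. [folklore] -/
theorem taggedKineticDensity_mono {κ κ' : ℝ} (h : κ ≤ κ') (ψ : Config (N + 1) → ℂ)
    (X : Config (N + 1)) : taggedKineticDensity κ ψ X ≤ taggedKineticDensity κ' ψ X :=
  add_le_add_left (mul_le_mul_left (ENNReal.ofReal_le_ofReal h) _) _

/-- A lighter tagged particle (larger `κ = m/M`) costs more energy on every state:
`κ ≤ κ' ⇒ ⟨Ψ, H_κ Ψ⟩ ≤ ⟨Ψ, H_κ' Ψ⟩`. [folklore] -/
theorem taggedPeriodicEnergy_mono {κ κ' : ℝ} (h : κ ≤ κ') (v : ℝ → ℝ≥0∞)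
    (Ψ : TaggedPeriodicTrialState N L) : taggedPeriodicEnergy v κ Ψ ≤ taggedPeriodicEnergy v κ' Ψ :=
  lintegral_mono fun X => add_le_add_left (taggedKineticDensity_mono h Ψ.ψ X) _

/-- **Monotonicity of the ground-state energy in the mass ratio**: `κ ≤ κ' ⇒ E_κ ≤ E_κ'` (the
infimum of a pointwise larger family). [folklore] -/
theorem taggedPeriodicGroundStateEnergy_mono {κ κ' : ℝ} (h : κ ≤ κ') (v : ℝ → ℝ≥0∞) (N : ℕ)
    (L : ℝ) : taggedPeriodicGroundStateEnergy v κ N L ≤ taggedPeriodicGroundStateEnergy v κ' N L :=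
  iInf_mono fun Ψ => taggedPeriodicEnergy_mono h v Ψ

/-- Non-positive weights act as the static limit `κ = 0`. [folklore] -/
theorem taggedKineticDensity_of_nonpos {κ : ℝ} (h : κ ≤ 0) (ψ : Config (N + 1) → ℂ)
    (X : Config (N + 1)) : taggedKineticDensity κ ψ X = taggedKineticDensity 0 ψ X := by
  simp only [taggedKineticDensity, ENNReal.ofReal_of_nonpos h, ENNReal.ofReal_zero]

/-- Non-positive weights act as the static limit `κ = 0`. [folklore] -/
theorem taggedPeriodicEnergy_of_nonpos {κ : ℝ} (h : κ ≤ 0) (v : ℝ → ℝ≥0∞)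
    (Ψ : TaggedPeriodicTrialState N L) : taggedPeriodicEnergy v κ Ψ = taggedPeriodicEnergy v 0 Ψ := by
  simp only [taggedPeriodicEnergy, taggedKineticDensity_of_nonpos h]

/-- At `κ = 0` only the bath moves: the kinetic density is `∑_{j ≥ 1} |∇ⱼΨ|²`. [folklore] -/
theorem taggedKineticDensity_zero (ψ : Config (N + 1) → ℂ) (X : Config (N + 1)) :
    taggedKineticDensity 0 ψ X = ∑ j : Fin N, gradSqAt[j.succ, ψ, X] := by
  simp only [taggedKineticDensity, ENNReal.ofReal_zero, zero_mul, zero_add]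

/-! ### Equal masses `κ = 1`: back to Fournais's `H(N+1, L)` -/

/-- At `κ = 1` the mass-deformed kinetic density is the full one, `|∇Ψ|² = ∑ᵢ |∇ᵢΨ|²`. [folklore] -/
theorem taggedKineticDensity_one (ψ : Config (N + 1) → ℂ) (X : Config (N + 1)) :
    taggedKineticDensity 1 ψ X = kineticDensity ψ X := by
  rw [taggedKineticDensity, ENNReal.ofReal_one, one_mul, kineticDensity, Fin.sum_univ_succ (n := N)]

/-- The periodised potential is even: `v^per(-y) = v^per(y)` (re-index the lattice sum by
`n ↦ -n`). [cite: Fournais2020, (1.1)] -/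
theorem periodizedPotential_neg (v : ℝ → ℝ≥0∞) (L : ℝ) (y : Space) :
    periodizedPotential v L (-y) = periodizedPotential v L y := by
  unfold periodizedPotential
  calc ∑' n : Fin 3 → ℤ, v ‖-y - latticeVec L n‖
      = ∑' n : Fin 3 → ℤ, (fun m => v ‖y - latticeVec L m‖) (Equiv.neg (Fin 3 → ℤ) n) :=
        tsum_congr fun n => by
          simp only [Equiv.neg_apply, latticeVec_neg, sub_neg_eq_add]
          rw [← norm_neg (y + latticeVec L n), neg_add']
    _ = ∑' m : Fin 3 → ℤ, v ‖y - latticeVec L m‖ :=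
        (Equiv.neg (Fin 3 → ℤ)).tsum_eq fun m => v ‖y - latticeVec L m‖

/-- `v^per(x - y) = v^per(y - x)`. [cite: Fournais2020, (1.1)] -/
theorem periodizedPotential_sub_comm (v : ℝ → ℝ≥0∞) (L : ℝ) (x y : Space) :
    periodizedPotential v L (x - y) = periodizedPotential v L (y - x) := by
  rw [← periodizedPotential_neg, neg_sub]

/-- **Splitting the pair sum at the tag**:
`∑_{0 ≤ i < j ≤ N} v^per(xᵢ - xⱼ) = ∑_{j ≥ 1} v^per(x₀ - xⱼ) + ∑_{1 ≤ i < j} v^per(xᵢ - xⱼ)`. [folklore] -/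
theorem periodicInteraction_succ (v : ℝ → ℝ≥0∞) (L : ℝ) (X : Config (N + 1)) :
    periodicInteraction v L X = (∑ j : Fin N, periodizedPotential v L (X 0 - X j.succ)) +
      periodicInteraction v L (Matrix.vecTail X) := by
  unfold periodicInteraction
  rw [Fin.sum_univ_succ (n := N)]
  congr 1
  · rw [Finset.sum_filter, Fin.sum_univ_succ (n := N), if_neg (lt_irrefl _), zero_add]
    exact Finset.sum_congr rfl fun j _ => if_pos (Fin.succ_pos j)
  · refine Finset.sum_congr rfl fun i _ => ?_
    rw [Finset.sum_filter, Finset.sum_filter, Fin.sum_univ_succ (n := N),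
      if_neg (not_lt.mpr (Fin.zero_le _)), zero_add]
    exact Finset.sum_congr rfl fun j _ => if_congr Fin.succ_lt_succ_iff rfl rfl

/-- **The tagged potential is the full pair interaction** of the `N + 1` particles (the tagged
boson couples like any other boson; `v^per` is even). [folklore] -/
theorem taggedInteraction_eq_periodicInteraction (v : ℝ → ℝ≥0∞) (L : ℝ) (X : Config (N + 1)) :
    taggedInteraction v L X = periodicInteraction v L X := by
  rw [periodicInteraction_succ, taggedInteraction, impurityInteraction]
  congr 1
  exact Finset.sum_congr rfl fun j _ => periodizedPotential_sub_comm v L _ _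

/-- **At `κ = 1` the tagged energy is Fournais's quadratic form** `⟨Ψ, H(N+1, L) Ψ⟩` (on a state
that need not be symmetric in the tagged particle). [cite: Fournais2020, (1.1)] -/
theorem taggedPeriodicEnergy_one (v : ℝ → ℝ≥0∞) (Ψ : TaggedPeriodicTrialState N L) :
    taggedPeriodicEnergy v 1 Ψ = ∫⁻ X in cellN (N + 1) L,
      kineticDensity Ψ.ψ X + periodicInteraction v L X * (‖Ψ.ψ X‖₊ : ℝ≥0∞) ^ 2 := by
  simp only [taggedPeriodicEnergy, taggedKineticDensity_one, taggedInteraction_eq_periodicInteraction]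

/-- A fully Bose-symmetric periodic `(N+1)`-body state is a tagged state (forget the symmetry in
the tag). [folklore] -/
def PeriodicTrialState.toTagged (Φ : PeriodicTrialState (N + 1) L) : TaggedPeriodicTrialState N L where
  ψ := Φ.ψ
  contDiff := Φ.contDiff
  periodic := Φ.periodic
  symm σ _ X := Φ.symm σ X
  norm_eq := Φ.norm_eq

/-- `Φ.toTagged` has the same wave function. [folklore] -/
@[simp]
theorem PeriodicTrialState.toTagged_ψ (Φ : PeriodicTrialState (N + 1) L) : Φ.toTagged.ψ = Φ.ψ :=
  rfl

/-- **Equal masses, symmetric state**: `taggedPeriodicEnergy v 1 Φ.toTagged = periodicEnergy v Φ`.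
[cite: Fournais2020, (1.1)] -/
theorem taggedPeriodicEnergy_one_toTagged (v : ℝ → ℝ≥0∞) (Φ : PeriodicTrialState (N + 1) L) :
    taggedPeriodicEnergy v 1 Φ.toTagged = periodicEnergy v Φ := by
  rw [taggedPeriodicEnergy_one]
  rfl

/-- At equal masses the tagged infimum (over the larger, bath-symmetric class) is below the
Bose-symmetric one: `E_{κ=1}(N, L) ≤ E(N+1, L)`. (Equality — the absolute ground state is the
symmetric one — is Perron–Frobenius and is not claimed here.) [cite: Fournais2020, (1.2)] -/
theorem taggedPeriodicGroundStateEnergy_one_le (v : ℝ → ℝ≥0∞) (N : ℕ) (L : ℝ) :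
    taggedPeriodicGroundStateEnergy v 1 N L ≤ periodicGroundStateEnergy v (N + 1) L :=
  le_iInf fun Φ => (iInf_le _ Φ.toTagged).trans_eq (taggedPeriodicEnergy_one_toTagged v Φ)

/-! ### Bath symmetry -/

/-- **Bath symmetry in `vecCons` form**: `Ψ(x₀, Y ∘ σ) = Ψ(x₀, Y)` for every permutation `σ` of the
bath labels (the lift of `σ` to `Fin (N+1)` fixing `0` is `Equiv.Perm.decomposeFin.symm (0, σ)`).
[folklore] -/
theorem TaggedPeriodicTrialState.symm_vecCons (Ψ : TaggedPeriodicTrialState N L)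
    (σ : Equiv.Perm (Fin N)) (x : Space) (Y : Config N) :
    Ψ.ψ (Matrix.vecCons x (Y ∘ σ)) = Ψ.ψ (Matrix.vecCons x Y) := by
  have h : (Matrix.vecCons x (Y ∘ σ) : Config (N + 1)) =
      Matrix.vecCons x Y ∘ Equiv.Perm.decomposeFin.symm (0, σ) := by
    funext i
    refine Fin.cases ?_ (fun j => ?_) i
    · simp [Equiv.Perm.decomposeFin_symm_apply_zero]
    · simp [Equiv.Perm.decomposeFin_symm_apply_succ, Equiv.swap_self]
  rw [h]
  exact Ψ.symm _ (Equiv.Perm.decomposeFin_symm_apply_zero 0 σ) _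

/-- A permutation of the `N + 1` labels fixing the tag `0` restricts to a permutation `σ` of the
bath labels: `τ (j+1) = σ(j) + 1`. [folklore] -/
theorem exists_perm_bath {τ : Equiv.Perm (Fin (N + 1))} (hτ : τ 0 = 0) :
    ∃ σ : Equiv.Perm (Fin N), ∀ j : Fin N, τ j.succ = (σ j).succ := by
  have h0 : ∀ j : Fin N, τ j.succ ≠ 0 := fun j h =>
    Fin.succ_ne_zero j (τ.injective (h.trans hτ.symm))
  have h0' : ∀ j : Fin N, τ.symm j.succ ≠ 0 := fun j h =>
    Fin.succ_ne_zero j (by rw [← τ.apply_symm_apply j.succ, h, hτ])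
  refine ⟨⟨fun j => (τ j.succ).pred (h0 j), fun j => (τ.symm j.succ).pred (h0' j),
    fun j => ?_, fun j => ?_⟩, fun j => ?_⟩
  · dsimp only
    rw [Fin.pred_eq_iff_eq_succ, Fin.succ_pred, Equiv.symm_apply_apply]
  · dsimp only
    rw [Fin.pred_eq_iff_eq_succ, Fin.succ_pred, Equiv.apply_symm_apply]
  · simp only [Equiv.coe_fn_mk, Fin.succ_pred]

/-- For a tag-fixing `τ`, the tail of `X ∘ τ` is a bath permutation of the tail of `X`. [folklore] -/
theorem exists_vecTail_comp_eq {τ : Equiv.Perm (Fin (N + 1))} (hτ : τ 0 = 0) :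
    ∃ σ : Equiv.Perm (Fin N), ∀ X : Config (N + 1),
      Matrix.vecTail (X ∘ τ) = Matrix.vecTail X ∘ σ := by
  obtain ⟨σ, hσ⟩ := exists_perm_bath hτ
  exact ⟨σ, fun X => funext fun j => by
    simp only [Matrix.vecTail, Function.comp_apply, hσ]⟩

/-! ### Boxes of non-positive side carry no tagged states -/

/-- A tagged trial state lives on a torus of positive side (its normalisation is impossible on an
empty cell). [folklore] -/
theorem TaggedPeriodicTrialState.side_pos (Ψ : TaggedPeriodicTrialState N L) : 0 < L := by
  by_contra h
  have h1 := Ψ.norm_eq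
  rw [cellN_succ_eq_empty (not_lt.mp h) N, Measure.restrict_empty, lintegral_zero_measure] at h1
  exact zero_ne_one h1

/-- For `L ≤ 0` there are no tagged trial states. [folklore] -/
theorem TaggedPeriodicTrialState.isEmpty_of_nonpos (hL : L ≤ 0) :
    IsEmpty (TaggedPeriodicTrialState N L) :=
  ⟨fun Ψ => (not_lt.mpr hL) Ψ.side_pos⟩

/-- For `L ≤ 0` the mass-deformed ground-state energy is `⊤` (empty infimum). [folklore] -/
theorem taggedPeriodicGroundStateEnergy_of_nonpos (v : ℝ → ℝ≥0∞) (κ : ℝ) (N : ℕ) (hL : L ≤ 0) :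
    taggedPeriodicGroundStateEnergy v κ N L = ⊤ := by
  haveI := TaggedPeriodicTrialState.isEmpty_of_nonpos (N := N) hL
  exact iInf_of_empty _

/-- **Shift of the fundamental cell** for tagged states: cell integrals of integrands periodic in
every particle and axis are invariant under any translation `T` of `(ℝ³)^{N+1}`. [folklore] -/
theorem TaggedPeriodicTrialState.lintegral_cellN_comp_sub (Ψ : TaggedPeriodicTrialState N L)
    {G : Config (N + 1) → ℝ≥0∞}
    (hG : ∀ (X : Config (N + 1)) (i : Fin (N + 1)) (k : Fin 3),
      G (X + Pi.single i (EuclideanSpace.single k L)) = G X)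
    (T : Config (N + 1)) :
    ∫⁻ X in cellN (N + 1) L, G (X - T) = ∫⁻ X in cellN (N + 1) L, G X := by
  simpa only [← sub_eq_add_neg] using lintegral_cellN_comp_add Ψ.side_pos hG (-T)

/-! ### Splitting off the tagged coordinate in cell integrals -/

/-- `(x₀, Y) ∈ [0,L)^{3(N+1)} ↔ x₀ ∈ [0,L)³ ∧ Y ∈ [0,L)^{3N}`. [folklore] -/
theorem vecCons_mem_cellN_succ_iff {x : Space} {Y : Config N} :
    (Matrix.vecCons x Y : Config (N + 1)) ∈ cellN (N + 1) L ↔ x ∈ cell L ∧ Y ∈ cellN N L := by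
  simp only [cellN, Set.mem_setOf_eq, Fin.forall_fin_succ, Matrix.cons_val_zero,
    Matrix.cons_val_succ]

/-- **Tonelli on the cell, tagged coordinate outermost**:
`∫_{[0,L)^{3(N+1)}} F = ∫_{[0,L)³} ∫_{[0,L)^{3N}} F(x₀, Y) dY dx₀` for measurable `F ≥ 0`. [folklore] -/
theorem setLIntegral_cellN_succ_left {F : Config (N + 1) → ℝ≥0∞} (hF : Measurable F) :
    ∫⁻ X in cellN (N + 1) L, F X = ∫⁻ x in cell L, ∫⁻ Y in cellN N L, F (Matrix.vecCons x Y) := by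
  have key : ∀ (x : Space) (Y : Config N), (cellN (N + 1) L).indicator F (Matrix.vecCons x Y) =
      (cell L).indicator
        (fun x => (cellN N L).indicator (fun Y => F (Matrix.vecCons x Y)) Y) x := by
    intro x Y
    by_cases hx : x ∈ cell L <;> by_cases hY : Y ∈ cellN N L <;>
      simp [Set.indicator, vecCons_mem_cellN_succ_iff, hx, hY]
  rw [← lintegral_indicator (measurableSet_cellN (N + 1) L),
    ← lintegral_lintegral_vecCons (hF.indicator (measurableSet_cellN (N + 1) L)),
    ← lintegral_indicator (measurableSet_cell L)]
  refine lintegral_congr fun x => ?_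
  simp only [key]
  by_cases hx : x ∈ cell L
  · simp only [Set.indicator_of_mem hx]
    rw [lintegral_indicator (measurableSet_cellN N L)]
  · simp only [Set.indicator_of_notMem hx, lintegral_zero]

/-- **Tonelli on the cell, tagged coordinate innermost**:
`∫_{[0,L)^{3(N+1)}} F = ∫_{[0,L)^{3N}} ∫_{[0,L)³} F(x₀, Y) dx₀ dY` for measurable `F ≥ 0`. [folklore] -/
theorem setLIntegral_cellN_succ_right {F : Config (N + 1) → ℝ≥0∞} (hF : Measurable F) :
    ∫⁻ X in cellN (N + 1) L, F X = ∫⁻ Y in cellN N L, ∫⁻ x in cell L, F (Matrix.vecCons x Y) := by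
  have key : ∀ (x : Space) (Y : Config N), (cellN (N + 1) L).indicator F (Matrix.vecCons x Y) =
      (cellN N L).indicator
        (fun Y => (cell L).indicator (fun x => F (Matrix.vecCons x Y)) x) Y := by
    intro x Y
    by_cases hx : x ∈ cell L <;> by_cases hY : Y ∈ cellN N L <;>
      simp [Set.indicator, vecCons_mem_cellN_succ_iff, hx, hY]
  rw [← lintegral_indicator (measurableSet_cellN (N + 1) L),
    lintegral_config_succ (hF.indicator (measurableSet_cellN (N + 1) L)),
    ← lintegral_indicator (measurableSet_cellN N L)]
  refine lintegral_congr fun Y => ?_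
  simp only [key]
  by_cases hY : Y ∈ cellN N L
  · simp only [Set.indicator_of_mem hY]
    rw [lintegral_indicator (measurableSet_cell L)]
  · simp only [Set.indicator_of_notMem hY, lintegral_zero]

/-! ### The tagged zero-mode occupation versus `condensateOccupation` -/

/-- **`(N+1) · ⟨Ψ, P_{Ω,0} Ψ⟩ = ⟨Ψ, n₀ Ψ⟩` as computed by `condensateOccupation`** (which tags the
head of `vecCons`): for every `(N+1)`-body function on a box of positive side,
`(N + 1) · taggedZeroModeOccupation N L Ψ = condensateOccupation (N+1) L Ψ`.
[cite: Fournais2020, (1.3)–(1.4)] -/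
theorem succ_mul_taggedZeroModeOccupation (hL : 0 < L) (Ψ : Config (N + 1) → ℂ) :
    (N + 1 : ℝ≥0∞) * taggedZeroModeOccupation N L Ψ = condensateOccupation (N + 1) L Ψ :=
  (condensateOccupation_succ hL Ψ).symm

/-- The tagged zero-mode occupation is the per-particle share of `condensateOccupation`:
`taggedZeroModeOccupation N L Ψ = condensateOccupation (N+1) L Ψ / (N+1)`. [cite: Fournais2020, (1.4)] -/
theorem taggedZeroModeOccupation_eq_div (hL : 0 < L) (Ψ : Config (N + 1) → ℂ) :
    taggedZeroModeOccupation N L Ψ = condensateOccupation (N + 1) L Ψ / (N + 1 : ℝ≥0∞) :=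
  (ENNReal.eq_div_iff (by positivity)
    (ENNReal.add_ne_top.2 ⟨ENNReal.natCast_ne_top N, ENNReal.one_ne_top⟩)).2
    (succ_mul_taggedZeroModeOccupation hL Ψ)

/-- **The tagged zero-mode occupation is at most `1`** on a tagged trial state
(Cauchy–Schwarz in `x₀`: `|∫_Ω Ψ(x₀,Y)dx₀|² ≤ L³ ∫_Ω |Ψ(x₀,Y)|² dx₀`, then the normalisation).
[cite: Fournais2020, (1.3)–(1.5) (0 ≤ P_Ω ≤ 1)] -/
theorem TaggedPeriodicTrialState.taggedZeroModeOccupation_le_one (Ψ : TaggedPeriodicTrialState N L) :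
    taggedZeroModeOccupation N L Ψ.ψ ≤ 1 := by
  have hm : Measurable Ψ.ψ := Ψ.contDiff.continuous.measurable
  have hF : Measurable fun X => (‖Ψ.ψ X‖₊ : ℝ≥0∞) ^ 2 :=
    (hm.nnnorm.coe_nnreal_ennreal).pow_const _
  have hL3 : ENNReal.ofReal L ^ 3 ≠ 0 := pow_ne_zero _ (ENNReal.ofReal_pos.2 Ψ.side_pos).ne'
  have hL3' : ENNReal.ofReal L ^ 3 ≠ ⊤ := ENNReal.pow_ne_top ENNReal.ofReal_ne_top
  -- Cauchy–Schwarz on the cell, slice by slice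
  have hCS : ∀ Y : Config N, (‖∫ x in cell L, Ψ.ψ (Matrix.vecCons x Y)‖₊ : ℝ≥0∞) ^ 2 ≤
      ENNReal.ofReal L ^ 3 * ∫⁻ x in cell L, (‖Ψ.ψ (Matrix.vecCons x Y)‖₊ : ℝ≥0∞) ^ 2 := by
    intro Y
    have h := sq_nnnorm_integral_mul_conj_le (ν := volume.restrict (cell L))
      (f := fun x => Ψ.ψ (Matrix.vecCons x Y)) (g := fun _ => (1 : ℂ))
      (measurable_comp_vecCons_left hm Y).aemeasurable aemeasurable_const
    simp only [map_one, mul_one, nnnorm_one, ENNReal.coe_one, one_pow, lintegral_const,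
      Measure.restrict_apply_univ, volume_cell, one_mul] at h
    exact h.trans_eq (mul_comm _ _)
  calc taggedZeroModeOccupation N L Ψ.ψ
      ≤ (ENNReal.ofReal L ^ 3)⁻¹ * ∫⁻ Y in cellN N L,
          ENNReal.ofReal L ^ 3 * ∫⁻ x in cell L, (‖Ψ.ψ (Matrix.vecCons x Y)‖₊ : ℝ≥0∞) ^ 2 := by
        unfold taggedZeroModeOccupation
        exact mul_le_mul_right (lintegral_mono fun Y => hCS Y) _
    _ = (ENNReal.ofReal L ^ 3)⁻¹ * (ENNReal.ofReal L ^ 3 *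
          ∫⁻ X in cellN (N + 1) L, (‖Ψ.ψ X‖₊ : ℝ≥0∞) ^ 2) := by
        rw [lintegral_const_mul' _ _ hL3', setLIntegral_cellN_succ_right hF]
    _ = 1 := by
        rw [Ψ.norm_eq, mul_one, ENNReal.inv_mul_cancel hL3 hL3']

/-! ### Product states `f(x₀) Φ(Y)` and the static limit `κ = 0` -/

/-- The product wave function `(x₀, Y) ↦ f(x₀) Φ(Y)` of a one-body function of the tagged particle
and an `N`-body function of the bath. [folklore] -/
def taggedProduct (f : Space → ℂ) (Φ : Config N → ℂ) (X : Config (N + 1)) : ℂ :=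
  f (X 0) * Φ (Matrix.vecTail X)

/-- `taggedProduct f Φ (x₀, Y) = f(x₀) Φ(Y)`. [folklore] -/
@[simp]
theorem taggedProduct_vecCons (f : Space → ℂ) (Φ : Config N → ℂ) (x : Space) (Y : Config N) :
    taggedProduct f Φ (Matrix.vecCons x Y) = f x * Φ Y := by
  simp only [taggedProduct, Matrix.cons_val_zero, Matrix.tail_cons]

/-- `tail (X + Y) = tail X + tail Y`. [folklore] -/
private theorem vecTail_add_aux (X Y : Config (N + 1)) :
    Matrix.vecTail (X + Y) = Matrix.vecTail X + Matrix.vecTail Y :=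
  rfl

/-- `tail (e_{j+1} ⊗ u) = e_j ⊗ u`. [folklore] -/
private theorem vecTail_single_succ_aux (j : Fin N) (u : Space) :
    Matrix.vecTail (Pi.single j.succ u : Config (N + 1)) = Pi.single j u := by
  funext i
  simp only [Matrix.vecTail, Function.comp_apply, Pi.single_apply, Fin.succ_inj]

/-- `tail (e_0 ⊗ u) = 0`. [folklore] -/
private theorem vecTail_single_zero_aux (u : Space) :
    Matrix.vecTail (Pi.single (0 : Fin (N + 1)) u : Config (N + 1)) = 0 := by
  funext i
  simp only [Matrix.vecTail, Function.comp_apply, Pi.single_apply, Fin.succ_ne_zero, if_false,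
    Pi.zero_apply]

/-- `tail : (ℝ³)^{N+1} → (ℝ³)^N` as a continuous linear map. [folklore] -/
private def tailL (N : ℕ) : Config (N + 1) →L[ℝ] Config N :=
  ContinuousLinearMap.pi fun j => ContinuousLinearMap.proj j.succ

/-- `tailL` is `Matrix.vecTail`. [folklore] -/
private theorem tailL_apply (X : Config (N + 1)) : tailL N X = Matrix.vecTail X :=
  rfl

/-- `tail` is `C^n`. [folklore] -/
private theorem contDiff_vecTail_aux :
    ContDiff ℝ 1 (Matrix.vecTail : Config (N + 1) → Config N) :=
  contDiff_pi' fun j => contDiff_apply ℝ Space j.succ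

/-- The product of `C¹` factors is `C¹`. [folklore] -/
theorem contDiff_taggedProduct {f : Space → ℂ} (hf : ContDiff ℝ 1 f) {Φ : Config N → ℂ}
    (hΦ : ContDiff ℝ 1 Φ) : ContDiff ℝ 1 (taggedProduct f Φ) :=
  (hf.comp (contDiff_apply ℝ Space 0)).mul (hΦ.comp contDiff_vecTail_aux)

/-- The product of periodic factors is periodic in every particle. [folklore] -/
theorem taggedProduct_periodic {f : Space → ℂ}
    (hfL : ∀ (x : Space) (k : Fin 3), f (x + EuclideanSpace.single k L) = f x)
    (Φ : PeriodicTrialState N L) (X : Config (N + 1)) (i : Fin (N + 1)) (k : Fin 3) :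
    taggedProduct f Φ.ψ (X + Pi.single i (EuclideanSpace.single k L)) = taggedProduct f Φ.ψ X := by
  refine Fin.cases ?_ (fun j => ?_) i
  · rw [taggedProduct, taggedProduct, Pi.add_apply, Pi.single_eq_same, hfL, vecTail_add_aux,
      vecTail_single_zero_aux, add_zero]
  · rw [taggedProduct, taggedProduct, Pi.add_apply, Pi.single_eq_of_ne (Fin.succ_ne_zero j).symm,
      add_zero, vecTail_add_aux, vecTail_single_succ_aux, Φ.periodic]

/-- The product state is symmetric in the bath. [folklore] -/
theorem taggedProduct_symm (f : Space → ℂ) (Φ : PeriodicTrialState N L)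
    {τ : Equiv.Perm (Fin (N + 1))} (hτ : τ 0 = 0) (X : Config (N + 1)) :
    taggedProduct f Φ.ψ (X ∘ τ) = taggedProduct f Φ.ψ X := by
  obtain ⟨σ, hσ⟩ := exists_vecTail_comp_eq (N := N) hτ
  rw [taggedProduct, taggedProduct, Function.comp_apply, hτ, hσ X, Φ.symm]

/-- Leibniz rule for the product: `D(fΦ)(X) = f(x₀) DΦ(Y) ∘ tail + Φ(Y) Df(x₀) ∘ proj₀`.
[folklore] -/
private theorem hasFDerivAt_taggedProduct {f : Space → ℂ} (hf : Differentiable ℝ f)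
    {Φ : Config N → ℂ} (hΦ : Differentiable ℝ Φ) (X : Config (N + 1)) :
    HasFDerivAt (taggedProduct f Φ)
      (f (X 0) • (fderiv ℝ Φ (Matrix.vecTail X)).comp (tailL N) +
        Φ (Matrix.vecTail X) • (fderiv ℝ f (X 0)).comp (ContinuousLinearMap.proj 0)) X := by
  have h1 : HasFDerivAt (fun X : Config (N + 1) => f (X 0))
      ((fderiv ℝ f (X 0)).comp (ContinuousLinearMap.proj 0)) X :=
    (hf (X 0)).hasFDerivAt.comp X (hasFDerivAt_apply 0 X)
  have h2 : HasFDerivAt (fun X : Config (N + 1) => Φ (Matrix.vecTail X))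
      ((fderiv ℝ Φ (Matrix.vecTail X)).comp (tailL N)) X :=
    (hΦ (Matrix.vecTail X)).hasFDerivAt.comp X (tailL N).hasFDerivAt
  exact h1.mul h2

/-- Bath derivatives of the product: `∂_{j+1,u}(fΦ)(X) = f(x₀) ∂_{j,u}Φ(Y)`. [folklore] -/
theorem fderiv_taggedProduct_single_succ {f : Space → ℂ} (hf : Differentiable ℝ f)
    {Φ : Config N → ℂ} (hΦ : Differentiable ℝ Φ) (X : Config (N + 1)) (j : Fin N) (u : Space) :
    fderiv ℝ (taggedProduct f Φ) X (Pi.single j.succ u) =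
      f (X 0) * fderiv ℝ Φ (Matrix.vecTail X) (Pi.single j u) := by
  rw [(hasFDerivAt_taggedProduct hf hΦ X).fderiv]
  simp only [add_apply, smul_apply, ContinuousLinearMap.comp_apply, ContinuousLinearMap.proj_apply,
    tailL_apply, vecTail_single_succ_aux, smul_eq_mul, Pi.single_eq_of_ne (Fin.succ_ne_zero j).symm, map_zero,
    mul_zero, add_zero]

/-- Tagged derivatives of the product: `∂_{0,u}(fΦ)(X) = Φ(Y) ∂_u f(x₀)`. [folklore] -/
theorem fderiv_taggedProduct_single_zero {f : Space → ℂ} (hf : Differentiable ℝ f)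
    {Φ : Config N → ℂ} (hΦ : Differentiable ℝ Φ) (X : Config (N + 1)) (u : Space) :
    fderiv ℝ (taggedProduct f Φ) X (Pi.single 0 u) = Φ (Matrix.vecTail X) * fderiv ℝ f (X 0) u := by
  rw [(hasFDerivAt_taggedProduct hf hΦ X).fderiv]
  simp only [add_apply, smul_apply, ContinuousLinearMap.comp_apply, ContinuousLinearMap.proj_apply,
    tailL_apply, vecTail_single_zero_aux, map_zero, smul_eq_mul, mul_zero, zero_add, Pi.single_eq_same]

/-- `|∇_{j+1}(fΦ)(X)|² = |f(x₀)|² |∇ⱼΦ(Y)|²`. [folklore] -/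
theorem gradSqAt_succ_taggedProduct {f : Space → ℂ} (hf : Differentiable ℝ f) {Φ : Config N → ℂ}
    (hΦ : Differentiable ℝ Φ) (X : Config (N + 1)) (j : Fin N) :
    gradSqAt[j.succ, taggedProduct f Φ, X] =
      (‖f (X 0)‖₊ : ℝ≥0∞) ^ 2 * gradSqAt[j, Φ, Matrix.vecTail X] := by
  rw [Finset.mul_sum]
  refine Finset.sum_congr rfl fun k _ => ?_
  rw [fderiv_taggedProduct_single_succ hf hΦ, nnnorm_mul, ENNReal.coe_mul, mul_pow]

/-- `|∇₀(fΦ)(X)|² = |Φ(Y)|² |∇f(x₀)|²`. [folklore] -/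
theorem gradSqAt_zero_taggedProduct {f : Space → ℂ} (hf : Differentiable ℝ f) {Φ : Config N → ℂ}
    (hΦ : Differentiable ℝ Φ) (X : Config (N + 1)) :
    gradSqAt[(0 : Fin (N + 1)), taggedProduct f Φ, X] =
      (‖Φ (Matrix.vecTail X)‖₊ : ℝ≥0∞) ^ 2 * gradSqC f (X 0) := by
  rw [gradSqC, Finset.mul_sum]
  refine Finset.sum_congr rfl fun k _ => ?_
  rw [fderiv_taggedProduct_single_zero hf hΦ, nnnorm_mul, ENNReal.coe_mul, mul_pow]

/-- **Kinetic density of a product state**: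
`κ|∇₀(fΦ)|² + ∑_{j≥1}|∇ⱼ(fΦ)|² = κ |Φ(Y)|² |∇f(x₀)|² + |f(x₀)|² |∇Φ(Y)|²`. [folklore] -/
theorem taggedKineticDensity_taggedProduct {f : Space → ℂ} (hf : Differentiable ℝ f)
    {Φ : Config N → ℂ} (hΦ : Differentiable ℝ Φ) (κ : ℝ) (X : Config (N + 1)) :
    taggedKineticDensity κ (taggedProduct f Φ) X =
      ENNReal.ofReal κ * ((‖Φ (Matrix.vecTail X)‖₊ : ℝ≥0∞) ^ 2 * gradSqC f (X 0)) +
        (‖f (X 0)‖₊ : ℝ≥0∞) ^ 2 * kineticDensity Φ (Matrix.vecTail X) := by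
  rw [taggedKineticDensity, gradSqAt_zero_taggedProduct hf hΦ, kineticDensity, Finset.mul_sum]
  congr 1
  exact Finset.sum_congr rfl fun j _ => gradSqAt_succ_taggedProduct hf hΦ X j

/-- **Product trial state** `(x₀, Y) ↦ f(x₀) Φ(Y)`: a one-body `C¹`, `Lℤ³`-periodic function `f` of
the tagged particle normalised on the cell (`∫_{[0,L)³} |f|² = 1`) times a periodic `N`-boson state
`Φ` of the bath is an admissible tagged state (the trial states of the static limit `κ = 0`, where
the tagged particle may be localised at no kinetic cost). [folklore] -/
def TaggedPeriodicTrialState.product (f : Space → ℂ) (hf : ContDiff ℝ 1 f)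
    (hfL : ∀ (x : Space) (k : Fin 3), f (x + EuclideanSpace.single k L) = f x)
    (hf1 : ∫⁻ x in cell L, (‖f x‖₊ : ℝ≥0∞) ^ 2 = 1) (Φ : PeriodicTrialState N L) :
    TaggedPeriodicTrialState N L where
  ψ := taggedProduct f Φ.ψ
  contDiff := contDiff_taggedProduct hf Φ.contDiff
  periodic := taggedProduct_periodic hfL Φ
  symm _ hσ := taggedProduct_symm f Φ hσ
  norm_eq := by
    have hm : Measurable fun X => (‖taggedProduct f Φ.ψ X‖₊ : ℝ≥0∞) ^ 2 :=
      ((contDiff_taggedProduct hf Φ.contDiff).continuous.measurable.nnnorm.coe_nnreal_ennreal).pow_const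
        _
    rw [setLIntegral_cellN_succ_left hm]
    simp only [taggedProduct_vecCons, nnnorm_mul, ENNReal.coe_mul, mul_pow]
    have h : ∀ x : Space, ∫⁻ Y in cellN N L, (‖f x‖₊ : ℝ≥0∞) ^ 2 * (‖Φ.ψ Y‖₊ : ℝ≥0∞) ^ 2 =
        (‖f x‖₊ : ℝ≥0∞) ^ 2 := fun x => by
      rw [lintegral_const_mul _ Φ.measurable_normSq, Φ.norm_eq, mul_one]
    simp only [h, hf1]

/-- The wave function of the product state. [folklore] -/
@[simp]
theorem TaggedPeriodicTrialState.product_ψ (f : Space → ℂ) (hf : ContDiff ℝ 1 f)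
    (hfL : ∀ (x : Space) (k : Fin 3), f (x + EuclideanSpace.single k L) = f x)
    (hf1 : ∫⁻ x in cell L, (‖f x‖₊ : ℝ≥0∞) ^ 2 = 1) (Φ : PeriodicTrialState N L) :
    (TaggedPeriodicTrialState.product f hf hfL hf1 Φ).ψ = taggedProduct f Φ.ψ :=
  rfl

/-- The periodised potential of a measurable profile is measurable. [folklore] -/
private theorem measurable_periodizedPotential_aux {v : ℝ → ℝ≥0∞} (hv : Measurable v) (L : ℝ) :
    Measurable (periodizedPotential v L) := by
  show Measurable fun x => ∑' n : Fin 3 → ℤ, v ‖x - latticeVec L n‖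
  exact Measurable.tsum fun n => hv.comp (measurable_id.sub_const _).norm

/-- The periodic pair interaction of a measurable profile is measurable. [folklore] -/
private theorem measurable_periodicInteraction_aux {v : ℝ → ℝ≥0∞} (hv : Measurable v) (L : ℝ)
    {M : ℕ} : Measurable fun X : Config M => periodicInteraction v L X := by
  unfold periodicInteraction
  refine Finset.measurable_sum _ fun i _ => Finset.measurable_sum _ fun j _ => ?_
  exact (measurable_periodizedPotential_aux hv L).comp
    ((measurable_pi_apply i).sub (measurable_pi_apply j))

/-- The pinned-scatterer potential of a measurable profile is measurable. [folklore] -/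
private theorem measurable_impurityInteraction_aux {v : ℝ → ℝ≥0∞} (hv : Measurable v) (L : ℝ)
    (x : Space) {M : ℕ} : Measurable fun Y : Config M => impurityInteraction v L x Y := by
  unfold impurityInteraction
  refine Finset.measurable_sum _ fun j _ => ?_
  have hj : Measurable fun Y : Config M => Y j := measurable_pi_apply j
  exact (measurable_periodizedPotential_aux hv L).comp (hj.sub_const x)

/-- `|∇f|²` is measurable (for any `f`). [folklore] -/
private theorem measurable_gradSqC_aux (f : Space → ℂ) : Measurable (gradSqC f) := by
  show Measurable fun x => ∑ k : Fin 3,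
    (‖fderiv ℝ f x (EuclideanSpace.single k (1 : ℝ))‖₊ : ℝ≥0∞) ^ 2
  refine Finset.measurable_sum _ fun k _ => ?_
  exact ((measurable_fderiv_apply_const ℝ f _).nnnorm.coe_nnreal_ennreal).pow_const _

/-- The tagged kinetic density is measurable (for any `ψ`). [folklore] -/
theorem measurable_taggedKineticDensity (κ : ℝ) (ψ : Config (N + 1) → ℂ) :
    Measurable fun X => taggedKineticDensity κ ψ X :=
  ((measurable_gradSqAt 0 ψ).const_mul _).add
    (Finset.measurable_sum _ fun j _ => measurable_gradSqAt j.succ ψ)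

/-- The tagged potential of a measurable profile is measurable. [folklore] -/
theorem measurable_taggedInteraction {v : ℝ → ℝ≥0∞} (hv : Measurable v) (L : ℝ) :
    Measurable fun X : Config (N + 1) => taggedInteraction v L X := by
  have h : (fun X : Config (N + 1) => taggedInteraction v L X) =
      fun X => periodicInteraction v L X :=
    funext fun X => taggedInteraction_eq_periodicInteraction v L X
  rw [h]
  exact measurable_periodicInteraction_aux hv L

/-- **Energy of a product state.** For measurable `v`, a one-body factor `f` and a bath state `Φ`,
`⟨fΦ, H_κ fΦ⟩ = κ ∫_{[0,L)³} |∇f|² + ∫_{[0,L)³} |f(x₀)|² ⟨Φ, (H(N,L) + ∑ⱼ v^per(xⱼ - x₀)) Φ⟩ dx₀`: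
the tagged particle's own kinetic energy plus the `|f|²`-average of the pinned-scatterer energy
`impurityPeriodicEnergy v x₀ Φ` of `PeriodicBoseGasImpurity.lean`. [folklore] -/
theorem taggedPeriodicEnergy_product {v : ℝ → ℝ≥0∞} (hv : Measurable v) (κ : ℝ) {f : Space → ℂ}
    (hf : ContDiff ℝ 1 f) (hfL : ∀ (x : Space) (k : Fin 3), f (x + EuclideanSpace.single k L) = f x)
    (hf1 : ∫⁻ x in cell L, (‖f x‖₊ : ℝ≥0∞) ^ 2 = 1) (Φ : PeriodicTrialState N L) :
    taggedPeriodicEnergy v κ (TaggedPeriodicTrialState.product f hf hfL hf1 Φ) =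
      ENNReal.ofReal κ * (∫⁻ x in cell L, gradSqC f x) +
        ∫⁻ x in cell L, (‖f x‖₊ : ℝ≥0∞) ^ 2 * impurityPeriodicEnergy v x Φ := by
  have hfd : Differentiable ℝ f := hf.differentiable one_ne_zero
  have hΦd : Differentiable ℝ Φ.ψ := Φ.contDiff.differentiable one_ne_zero
  have hmeas : Measurable fun X : Config (N + 1) => taggedKineticDensity κ (taggedProduct f Φ.ψ) X +
      taggedInteraction v L X * (‖taggedProduct f Φ.ψ X‖₊ : ℝ≥0∞) ^ 2 :=
    (measurable_taggedKineticDensity κ _).add ((measurable_taggedInteraction hv L).mul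
      (((contDiff_taggedProduct hf Φ.contDiff).continuous.measurable.nnnorm.coe_nnreal_ennreal).pow_const
        _))
  rw [taggedPeriodicEnergy, TaggedPeriodicTrialState.product_ψ, setLIntegral_cellN_succ_left hmeas]
  -- the integrand on the slice `(x, Y)`
  have hpt : ∀ (x : Space) (Y : Config N),
      taggedKineticDensity κ (taggedProduct f Φ.ψ) (Matrix.vecCons x Y) +
          taggedInteraction v L (Matrix.vecCons x Y) *
            (‖taggedProduct f Φ.ψ (Matrix.vecCons x Y)‖₊ : ℝ≥0∞) ^ 2 =
        ENNReal.ofReal κ * gradSqC f x * (‖Φ.ψ Y‖₊ : ℝ≥0∞) ^ 2 +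
          (‖f x‖₊ : ℝ≥0∞) ^ 2 * (kineticDensity Φ.ψ Y +
            (periodicInteraction v L Y * (‖Φ.ψ Y‖₊ : ℝ≥0∞) ^ 2 +
              impurityInteraction v L x Y * (‖Φ.ψ Y‖₊ : ℝ≥0∞) ^ 2)) := by
    intro x Y
    rw [taggedKineticDensity_taggedProduct hfd hΦd, taggedInteraction, taggedProduct_vecCons]
    simp only [Matrix.cons_val_zero, Matrix.tail_cons, nnnorm_mul, ENNReal.coe_mul, mul_pow]
    ring
  simp only [hpt]
  -- the inner integral over the bath
  have hinner : ∀ x : Space,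
      ∫⁻ Y in cellN N L, (ENNReal.ofReal κ * gradSqC f x * (‖Φ.ψ Y‖₊ : ℝ≥0∞) ^ 2 +
          (‖f x‖₊ : ℝ≥0∞) ^ 2 * (kineticDensity Φ.ψ Y +
            (periodicInteraction v L Y * (‖Φ.ψ Y‖₊ : ℝ≥0∞) ^ 2 +
              impurityInteraction v L x Y * (‖Φ.ψ Y‖₊ : ℝ≥0∞) ^ 2))) =
        ENNReal.ofReal κ * gradSqC f x + (‖f x‖₊ : ℝ≥0∞) ^ 2 * impurityPeriodicEnergy v x Φ := by
    intro x
    have himp : Measurable fun Y : Config N =>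
        impurityInteraction v L x Y * (‖Φ.ψ Y‖₊ : ℝ≥0∞) ^ 2 :=
      (measurable_impurityInteraction_aux hv L x).mul Φ.measurable_normSq
    rw [lintegral_add_left (Φ.measurable_normSq.const_mul _), lintegral_const_mul _ Φ.measurable_normSq,
      Φ.norm_eq, mul_one, lintegral_const_mul' _ _ (ENNReal.pow_ne_top ENNReal.coe_ne_top),
      impurityPeriodicEnergy_eq, periodicEnergy, ← lintegral_add_right _ himp]
    simp only [add_assoc]
  simp only [hinner]
  rw [lintegral_add_left ((measurable_gradSqC_aux f).const_mul _),
    lintegral_const_mul _ (measurable_gradSqC_aux f)]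

/-- **Static limit `κ = 0`**: the energy of the product state `f(x₀)Φ(Y)` is the `|f|²`-average of
the pinned-scatterer energy, `⟨fΦ, H₀ fΦ⟩ = ∫_{[0,L)³} |f(x₀)|² impurityPeriodicEnergy v x₀ Φ dx₀`
(an infinitely heavy particle may be localised anywhere at no kinetic cost). [folklore] -/
theorem taggedPeriodicEnergy_zero_product {v : ℝ → ℝ≥0∞} (hv : Measurable v) {f : Space → ℂ}
    (hf : ContDiff ℝ 1 f) (hfL : ∀ (x : Space) (k : Fin 3), f (x + EuclideanSpace.single k L) = f x)
    (hf1 : ∫⁻ x in cell L, (‖f x‖₊ : ℝ≥0∞) ^ 2 = 1) (Φ : PeriodicTrialState N L) :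
    taggedPeriodicEnergy v 0 (TaggedPeriodicTrialState.product f hf hfL hf1 Φ) =
      ∫⁻ x in cell L, (‖f x‖₊ : ℝ≥0∞) ^ 2 * impurityPeriodicEnergy v x Φ := by
  rw [taggedPeriodicEnergy_product hv, ENNReal.ofReal_zero, zero_mul, zero_add]

/-- In the static limit the tagged ground-state energy is bounded by any `|f|²`-average of
pinned-scatterer energies. [folklore] -/
theorem taggedPeriodicGroundStateEnergy_zero_le {v : ℝ → ℝ≥0∞} (hv : Measurable v)
    {f : Space → ℂ} (hf : ContDiff ℝ 1 f)
    (hfL : ∀ (x : Space) (k : Fin 3), f (x + EuclideanSpace.single k L) = f x)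
    (hf1 : ∫⁻ x in cell L, (‖f x‖₊ : ℝ≥0∞) ^ 2 = 1) (Φ : PeriodicTrialState N L) :
    taggedPeriodicGroundStateEnergy v 0 N L ≤
      ∫⁻ x in cell L, (‖f x‖₊ : ℝ≥0∞) ^ 2 * impurityPeriodicEnergy v x Φ :=
  (taggedPeriodicGroundStateEnergy_le v 0 _).trans_eq (taggedPeriodicEnergy_zero_product hv hf hfL hf1 Φ)

/-! ### Translation covariance -/

/-- The mass-deformed kinetic density commutes with translations:
`taggedKineticDensity κ (ψ(· - T)) X = taggedKineticDensity κ ψ (X - T)`. [folklore] -/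
theorem taggedKineticDensity_comp_sub_const (κ : ℝ) (ψ : Config (N + 1) → ℂ)
    (T X : Config (N + 1)) :
    taggedKineticDensity κ (fun Y => ψ (Y - T)) X = taggedKineticDensity κ ψ (X - T) := by
  simp only [taggedKineticDensity, fderiv_comp_sub]

/-- The mass-deformed kinetic density of a tagged state is periodic in every particle and axis.
[folklore] -/
theorem TaggedPeriodicTrialState.taggedKineticDensity_add_single (Ψ : TaggedPeriodicTrialState N L)
    (κ : ℝ) (X : Config (N + 1)) (i : Fin (N + 1)) (k : Fin 3) :
    taggedKineticDensity κ Ψ.ψ (X + Pi.single i (EuclideanSpace.single k L)) =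
      taggedKineticDensity κ Ψ.ψ X := by
  have h : (fun Y => Ψ.ψ (Y + Pi.single i (EuclideanSpace.single k L))) = Ψ.ψ :=
    funext fun Y => Ψ.periodic Y i k
  conv_rhs => rw [← h]
  simp only [taggedKineticDensity, fderiv_comp_add_right]

/-- The tagged potential is periodic in every particle and axis. [cite: Fournais2020, (1.1)] -/
theorem taggedInteraction_add_single (v : ℝ → ℝ≥0∞) (L : ℝ) (X : Config (N + 1)) (i : Fin (N + 1))
    (k : Fin 3) :
    taggedInteraction v L (X + Pi.single i (EuclideanSpace.single k L)) = taggedInteraction v L X := by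
  rw [taggedInteraction_eq_periodicInteraction, taggedInteraction_eq_periodicInteraction,
    periodicInteraction_add_single]

/-- A common translation of all `N + 1` particles leaves the tagged potential unchanged. [folklore] -/
theorem taggedInteraction_add_const (v : ℝ → ℝ≥0∞) (L : ℝ) (X : Config (N + 1)) (t : Space) :
    taggedInteraction v L (X + fun _ => t) = taggedInteraction v L X := by
  rw [taggedInteraction_eq_periodicInteraction, taggedInteraction_eq_periodicInteraction,
    periodicInteraction_add_const]

/-- **Translation of a tagged trial state**: `(τ_t Ψ)(x₀, …, x_N) = Ψ(x₀ - t, …, x_N - t)`, all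
`N + 1` particles moved by the same `t ∈ ℝ³`, is again an admissible tagged state. [folklore] -/
theorem TaggedPeriodicTrialState.exists_translate (Ψ : TaggedPeriodicTrialState N L) (t : Space) :
    ∃ Ψ' : TaggedPeriodicTrialState N L, Ψ'.ψ = fun X => Ψ.ψ (X - fun _ => t) := by
  refine ⟨{ ψ := fun X => Ψ.ψ (X - fun _ => t)
            contDiff := Ψ.contDiff.comp (contDiff_id.sub contDiff_const)
            periodic := fun X i k => ?_
            symm := fun σ hσ X => ?_
            norm_eq := ?_ }, rfl⟩
  · show Ψ.ψ (X + Pi.single i (EuclideanSpace.single k L) - fun _ => t) = Ψ.ψ (X - fun _ => t)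
    rw [add_sub_right_comm, Ψ.periodic]
  · show Ψ.ψ ((X ∘ σ) - fun _ => t) = Ψ.ψ (X - fun _ => t)
    have h : ((X ∘ σ) - fun _ => t) = (X - fun _ => t) ∘ σ := funext fun _ => rfl
    rw [h]
    exact Ψ.symm σ hσ _
  · show ∫⁻ X in cellN (N + 1) L, (‖Ψ.ψ (X - fun _ => t)‖₊ : ℝ≥0∞) ^ 2 = 1
    rw [Ψ.lintegral_cellN_comp_sub (G := fun X => (‖Ψ.ψ X‖₊ : ℝ≥0∞) ^ 2)
      (fun X i k => by simp only [Ψ.periodic]) fun _ => t]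
    exact Ψ.norm_eq

/-- **Translation invariance of the mass-deformed torus Hamiltonian**:
`⟨τ_t Ψ, H_κ τ_t Ψ⟩ = ⟨Ψ, H_κ Ψ⟩`. [cite: GuentherEtAl2021, eq. (4) (translation invariance on the torus)] -/
theorem taggedPeriodicEnergy_translate (v : ℝ → ℝ≥0∞) (κ : ℝ) (Ψ : TaggedPeriodicTrialState N L)
    (t : Space) {Ψ' : TaggedPeriodicTrialState N L} (hΨ' : Ψ'.ψ = fun X => Ψ.ψ (X - fun _ => t)) :
    taggedPeriodicEnergy v κ Ψ' = taggedPeriodicEnergy v κ Ψ := by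
  unfold taggedPeriodicEnergy
  rw [hΨ']
  set G : Config (N + 1) → ℝ≥0∞ := fun X =>
    taggedKineticDensity κ Ψ.ψ X + taggedInteraction v L X * (‖Ψ.ψ X‖₊ : ℝ≥0∞) ^ 2 with hG_def
  have hG : ∀ (X : Config (N + 1)) (i : Fin (N + 1)) (k : Fin 3),
      G (X + Pi.single i (EuclideanSpace.single k L)) = G X := fun X i k => by
    simp only [hG_def, Ψ.taggedKineticDensity_add_single, taggedInteraction_add_single, Ψ.periodic]
  calc ∫⁻ X in cellN (N + 1) L, taggedKineticDensity κ (fun Y => Ψ.ψ (Y - fun _ => t)) X +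
          taggedInteraction v L X * (‖(fun Y => Ψ.ψ (Y - fun _ => t)) X‖₊ : ℝ≥0∞) ^ 2
      = ∫⁻ X in cellN (N + 1) L, G (X - fun _ => t) := lintegral_congr fun X => by
          simp only [hG_def, taggedKineticDensity_comp_sub_const]
          rw [← taggedInteraction_add_const v L (X - fun _ => t) t, sub_add_cancel]
    _ = ∫⁻ X in cellN (N + 1) L, G X := Ψ.lintegral_cellN_comp_sub hG _

/-! ### Non-vacuity: the constant state -/

/-- **Non-vacuity.** For `L > 0` the constant function `Ψ ≡ L^{-3(N+1)/2}` is an admissible tagged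
trial state. [folklore] -/
def TaggedPeriodicTrialState.const (N : ℕ) (hL : 0 < L) : TaggedPeriodicTrialState N L where
  ψ _ := ((Real.sqrt (L ^ 3))⁻¹ : ℂ) ^ (N + 1)
  contDiff := contDiff_const
  periodic _ _ _ := rfl
  symm _ _ _ := rfl
  norm_eq := by
    have h3 : ENNReal.ofReal L ^ 3 ≠ 0 := pow_ne_zero _ (ENNReal.ofReal_pos.2 hL).ne'
    rw [setLIntegral_const, volume_cellN, nnnorm_pow, ENNReal.coe_pow, ← pow_mul,
      mul_comm (N + 1) 2, pow_mul, nnnorm_constantMode_sq hL, ← mul_pow,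
      ENNReal.inv_mul_cancel h3 (ENNReal.pow_ne_top ENNReal.ofReal_ne_top), one_pow]

/-- For `L > 0` the tagged trial states are inhabited. [folklore] -/
theorem TaggedPeriodicTrialState.nonempty (N : ℕ) (hL : 0 < L) :
    Nonempty (TaggedPeriodicTrialState N L) :=
  ⟨TaggedPeriodicTrialState.const N hL⟩

end Literature.MathematicalPhysics.QuantumManyBody.BoseGas

end
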